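import Summits.Ventures.AbcSig.Rows.TemplateC2a
import Summits.Ventures.AbcSig.Levels.N634
import Summits.Ventures.AbcSig.Levels.N10144

/-!
# Venture AbcSig — ROW `C2aL317A0`: `xⁿ + 2^a·317^m·yⁿ = z²`, class `a 0` (GENERATED by plean/leanrow.py)

HONEST FRAMING. A row of a COMPUTATION cell (`pub-abcsig`); a CONDITIONAL theorem, no claim on ABC or any summit.
Hypotheses: `BS04Package` (CITED), `DataComplete` at levels [634, 10144] (COMPUTED, two-engine certified
level files), and the listed per-orbit exclusions `hX_…` (CITED; the
row's R5 cell names each). Everything else is kernel-checked (`Rows/TemplateC2a.lean`, `Levels/N….lean`). Exponent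
range: prime `n ≥ 11`, `n ≠ 317`, n ∉ [37]; `B = 2^a 317^m` with `a, m < n` (n-th-power free).
Row of record: `census/rows/C2a/C2a-l317-a0.md` (sha256 `1603d3b5d4aba057…`; SIGNED 2026-08-22T17:51:55Z by referee (ref-g14)); its R0: THEOREM for primes n >= 11, n not in [37] (uses CITED facts); the survivors [37] need M4 (Kraus) / stay open — class: candidate (a ∈ {0,3} cell, BATCH-03; lit/C. Exponents left open by the row of record are excluded here via `hres`; kernel-sieve residuals the row of record closes by a cell module (M6 Eisenstein / M4 Kraus certificates) appear as CITED hypotheses `hX_…`.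
-/

namespace Summit.Ventures.AbcSig

/-- Row `C2aL317A0` (see module docstring). -/
theorem row_C2aL317A0 (M : NewformModel) (hP : M.BS04Package)
    (hD634 : M.DataComplete 634 level634Orbits) (hD10144 : M.DataComplete 10144 level10144Orbits)
    (n : ℕ) (hn : n.Prime) (hmin : 11 ≤ n) (hnℓ : n ≠ 317) (hres : n ∉ ([37] : List ℕ)) (m : ℕ) (hm : 1 ≤ m) (hmn : m < n)
    (hX_orbit_634_4 : n ∈ ([53] : List ℕ) → M.Excludes 634 orbit_634_4 (famB (2 ^ 0 * 317 ^ m) n (fun _ _ => True)))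
    (hX_orbit_10144_7 : n ∈ ([17] : List ℕ) → M.Excludes 10144 orbit_10144_7 (famB (2 ^ 0 * 317 ^ m) n (fun _ _ => True)))
    (hX_orbit_10144_8 : n ∈ ([13] : List ℕ) → M.Excludes 10144 orbit_10144_8 (famB (2 ^ 0 * 317 ^ m) n (fun _ _ => True)))
    (x y z : ℤ) (hxy1 : x * y ≠ 1) (hxy2 : x * y ≠ -1) : ¬ IsPrimitiveSolution 1 (2 ^ 0 * 317 ^ m) 1 n x y z := by
  have hℓ : Nat.Prime 317 := by norm_num
  have h7 : 7 ≤ n := by omega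
  have hS634 :=
    (level634_sieve n hn h7 (fun o => M.Excludes 634 o (famB (2 ^ 0 * 317 ^ m) n (fun _ _ => True))) hX_orbit_634_4)
  have hS10144 :=
    (level10144_sieve n hn h7 (fun o => M.Excludes 10144 o (famB (2 ^ 0 * 317 ^ m) n (fun _ _ => True))) (fun h => absurd h (by simp only [List.mem_cons, List.not_mem_nil, or_false] at hres ⊢; omega)) (fun h => absurd h (by simp only [List.mem_cons, List.not_mem_nil, or_false] at hres ⊢; omega)) (fun h => absurd h (by simp only [List.mem_cons, List.not_mem_nil, or_false] at hres ⊢; omega)) (fun h => absurd h (by simp only [List.mem_cons, List.not_mem_nil, or_false] at hres ⊢; omega)) hX_orbit_10144_7 hX_orbit_10144_8 (fun h => absurd h (by simp only [List.mem_cons, List.not_mem_nil, or_false] at hres ⊢; omega)) (fun h => absurd h (by simp only [List.mem_cons, List.not_mem_nil, or_false] at hres ⊢; omega)))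
  exact rowC2a_a0 317 hℓ (by norm_num) M hP n hn h7 hnℓ hD10144 hD634 m hm hmn
    hS10144
    hS634 x y z hxy1 hxy2

end Summit.Ventures.AbcSig
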